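import Summits.HodgeConjecture.HodgeConjecture.Theorems.Ring2AbelianAllSpreadPerClass
import Summits.HodgeConjecture.HodgeConjecture.Theorems.Ring2DeformQbarDescent
import HarnessLib

/-!
# Ring 2 · §AbelianAll · SPREAD, part VIII — the `ℚ̄`-SPREAD: row U factored through the fibres definable over
# `ℚ̄`, and the exact fact-free complement `F_ℚ̄` of the arithmetic endpoint `HC_QbarAV`

research route, not a corollary; conditional on HC_CM plus one named minimal statement.
Research route conditional on HC_CM; not a corollary; Q11.4-sentence-2 already refuted in dim ≥ 3.

`HC_CM` = `Theses.RankFourFaces.CMAbelianHodge` (OPEN item stmt-3052), a BINDER wherever it occurs, never a fact.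
`HC_AV` = `Theses.PadicSemiregularLift.HodgeAbelianVarieties` (stmt-1333). `HC_QbarAV` = deform's endpoint
`Ring2.Deform.HodgeConjectureQbarAV` (Hodge for the complexifications of abelian varieties over `ℚ̄ ⊂ ℂ`; OPEN);
`Spread_AV` = `CMIdle HC_QbarAV` = `HC_QbarAV → HC_AV` (deform XV; OPEN). The item `CMToAbelian`
(stmt-HodgeConjecture-16267) stays OPEN and is not re-filed. Deligne's CM-dense Mumford–Tate families enter as the
HYPOTHESIS `hF : deligne1982_cmDenseMumfordTateFamilies` (fact #20, printed, not kernel-proved, never cited as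
known); the descent of CM abelian varieties to `ℚ̄` enters as deform's inline binder `hdesc` VERBATIM (isogeny
form), never as a fact. No Literature record; nothing minted here is cited anywhere as a fact; "minimal" is not
claimed (F-ab-4).

WHAT IS TYPED (deform D.69 (c) asked for a Hodge-locus carrier with field of definition — none is needed: the
`ℚ̄`-fibres are typed FIBREWISE, like `cmLocus`). §A `qbarLocus f n` = deform's `cmLocus f n` with `IsOfCMType A₀`
replaced by "`A₀` is isogenous to the complexification of an abelian variety over `ℚ̄`" (isogeny-closed so that
`hdesc` applies verbatim; Hodge is an isogeny invariant); `cmLocus ⊆ qbarLocus` mod `hdesc`; `HC_QbarAV` makes a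
fibrewise rational `(p,p)` global class algebraic at every `ℚ̄`-fibre. §B per family: `QbarSpreadingOn f n`
(algebraic at all `ℚ̄`-fibres ⟹ at all fibres), `CMToQbarSpreadingOn f n` (at all CM fibres ⟹ at all `ℚ̄`-fibres);
`∀ s, CMSpreadingTo f n s` is their conjunction mod `hdesc`. §C nodes, `@[conjecture]`, OPEN, hypotheses wherever
used: **U_ℚ̄** `UniformAlgebraicityAtQbarPoints`, **U_{CM→ℚ̄}** `CMToQbarSpreading` (row U's carrier VERBATIM,
spreading clause replaced), **F_ℚ̄** `HodgeFailureSpreadsToQbarFibre` (part VII's F_CM with the bad CM fibre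
replaced by a bad `ℚ̄`-fibre; datum `IsCMAnchoredDatumFor` VERBATIM). KERNEL: §D **`U ⟺ U_ℚ̄ ∧ U_{CM→ℚ̄}` mod
`hdesc`** (`⟸` and `U ⟹ U_{CM→ℚ̄}` fact-free): row U = an ARITHMETIC half "CM ⟹ `ℚ̄`" ∧ a TRANSCENDENTAL half
"`ℚ̄` ⟹ `ℂ`"; every node on path fact-free; `AbelianSchemeVHC ⟹ U_ℚ̄` mod `hdesc`. §E **`HC_QbarAV ∧ U_ℚ̄ ⟹ HC_AV`
mod `hF`**, i.e. **`Spread_AV ⟸ U_ℚ̄` mod `hF`** — `Spread_AV` priced by ONE node strictly below U, with no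
`HC_CM`, no `LocalVHCAtCM`, no Hodge-locus carrier; **`HC_CM ∧ U_{CM→ℚ̄} ⟹ HC_QbarAV` mod `hF`**; exact rows
`HC_AV ⟺ HC_QbarAV ∧ U_ℚ̄` [hF], `HC_QbarAV ⟺ HC_CM ∧ U_{CM→ℚ̄}` [hF, hdesc], `ExactWithCM (U_{CM→ℚ̄} ∧ U_ℚ̄)` [hF].
§F with NO named fact: **`HC_AV ⟺ HC_QbarAV ∧ F_ℚ̄`**, **`Spread_AV ⟺ (HC_QbarAV → F_ℚ̄)`**; `F_CM ⟹ F_ℚ̄` mod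
`hdesc`; `U_ℚ̄ ⟹ F_ℚ̄` mod `hF`.

HONEST COLUMN. (1) U_ℚ̄ and F_ℚ̄ are complements of `HC_QbarAV`, NOT of `HC_CM` (a `ℚ̄`-fibre need not be CM); they
FACTOR the cell's complements (U, F_CM) and deform's `Spread_AV`; no new `B_min` candidate; nothing here is
progress on the summit. (2) Contrast: typer 2 XXIV prices `Spread_AV` by `CMAnchoredFamilies ∧ LocalVHCAtCM`
THROUGH `HC_CM`; here the non-CM `ℚ̄`-fibres carry the load and `HC_CM` does not occur in `Spread_AV ⟸ U_ℚ̄`.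
(3) Why U_ℚ̄ is open: the `ℚ̄`-fibres are a countable dense set, the algebraicity locus a countable union of
closed strata (Charles–Schnell 11.3.11) — density forces nothing without uniformity (Markman's
`cmDensity_insufficient` verbatim); print controls the field of definition of components of HODGE loci through a
`ℚ̄`-point (Saito–Schnell Thm. 1; Voisin 2007 Thm. 0.6; Klingler–Otwinowska–Urbanik 1.12), not algebraicity along
them; Voisin's `HC/ℚ̄ ⟹ HC` runs through the TOTAL SPACE (tree: stmt-1070 ⟹ stmt-1333), not abelian-internally.
(4) F_ℚ̄'s datum is CM-POINTED, not CM-dense, as in F_CM. (5) PRINT STATUS: none of U_ℚ̄, U_{CM→ℚ̄}, F_ℚ̄,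
`Spread_AV` is in print (searched corpus fts + hybrid + vector and galaxy; nearest [KerrPearlstein2016, Ch. 10
Thm. 1–2, Cor. 1], [Voisin2007HodgeLoci, Thm. 0.6, Prop. 1.2], [CharlesSchnell2014Notes, 11.3.11, 11.5.11]).
-/

-- The cell namespace repeats the summit's name (`Summit.HodgeConjecture.HodgeConjecture.…`, D-0017 nested layout);
-- the duplication is the tree convention, not a slip.
set_option linter.dupNamespace false

namespace Summit.HodgeConjecture.HodgeConjecture.Ring2.AbelianAll

open CategoryTheory AlgebraicGeometry
open Literature.AlgebraicGeometry Literature.AlgebraicGeometry.Motives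
open Literature.AlgebraicGeometry.HodgeTheory
open Literature.AlgebraicGeometry.Milne1999 (IsOfCMType)
open Literature.AlgebraicGeometry.Deligne1982 (deligne1982_cmDenseMumfordTateFamilies IsCMDenseMumfordTateFamilyFor)
open Summit.HodgeConjecture.HodgeConjecture
open Summit.HodgeConjecture.HodgeConjecture.Theses
open Summit.HodgeConjecture.HodgeConjecture.Theses.RankFourFaces (CMAbelianHodge CMToAbelian)
open Summit.HodgeConjecture.HodgeConjecture.Theses.PadicSemiregularLift (HodgeAbelianVarieties)
open Summit.HodgeConjecture.HodgeConjecture.Ring2.Deform (cmLocus CMSpreadingTo UniformAlgebraicityAtCMPoints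
  HodgeConjectureQbarAV forall_cmLocus_mem_algebraicClasses_of_HC_CM uniformAlgebraicityAtCMPoints_iff_spreading
  hodgeConjectureQbarAV_of_HC_AV HC_CM_of_hodgeConjectureQbarAV_of_cmQbarDescent)
open Summit.HodgeConjecture.HodgeConjecture.Ring2.Hypotheses (AbelianSchemeVHC)
open Summit.HodgeConjecture.HodgeConjecture.Theorems.HodgeAbelianVarieties.Negative (iff_hodgeConjecture_restricted)

local notation "ℚal" => IntermediateField.toSubfield (algebraicClosure ℚ ℂ)

variable {𝒳 S : SchemeOver ℂ}

/-! ## §A The `ℚ̄`-locus of an abelian-fibred family (a `Set`-valued definition; nothing asserted) -/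

/-- **The `ℚ̄`-locus of `f : 𝒳 ⟶ S`**: the points `s ∈ S(ℂ)` whose fibre `𝒳_s` is charted by a complex abelian
variety `A₀` of dimension `n` ISOGENOUS to the complexification `A₁ ⊗ ℂ` of an abelian variety `A₁` over
`ℚ^al ⊂ ℂ` — deform's `cmLocus f n` with the CM clause replaced by `ℚ̄`-definability up to isogeny ("defined
over `k`" = isomorphic to a base change, Saito–Schnell p. 275; isogeny-closed so that deform's binder `hdesc`
applies verbatim). [cite: KerrPearlstein2016, Ch. 10 p. 275] [cite: vanGeemen1994HodgeAV, Lemma 3.7] -/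
def qbarLocus (f : 𝒳 ⟶ S) (n : ℕ) : Set (ComplexPoints S) :=
  {s | ∃ A₀ : AbelianVariety ℂ, Nonempty (A₀.X ≅ fiberOver f s) ∧ A₀.dim = n ∧
    ∃ A₁ : AbelianVariety ℚal, AbelianVariety.IsIsogenous A₀ (A₁.baseChange ℂ)}

/-- A fibre charted by a complexification `A₁ ⊗ ℂ` lies in the `ℚ̄`-locus (identity isogeny). [folklore] -/
theorem mem_qbarLocus_of_baseChange_chart (f : 𝒳 ⟶ S) (A₁ : AbelianVariety ℚal) {s : ComplexPoints S}
    (e : (A₁.baseChange ℂ).X ≅ fiberOver f s) : s ∈ qbarLocus f (A₁.baseChange ℂ).dim :=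
  ⟨A₁.baseChange ℂ, ⟨e⟩, rfl, A₁, 𝟙 _, AbelianVariety.isIsogeny_id _⟩

/-- **CM fibres are `ℚ̄`-fibres, modulo the printed descent of CM abelian varieties to `ℚ̄`** (deform's binder
`hdesc`, verbatim): `cmLocus ⊆ qbarLocus`. [cite: Shimura1998, §12.4 Prop. 26] [cite: Oort1973, Title theorem] -/
theorem cmLocus_subset_qbarLocus_of_cmQbarDescent
    (hdesc : ∀ A : AbelianVariety ℂ, IsOfCMType A →
      ∃ A₀ : AbelianVariety ℚal, AbelianVariety.IsIsogenous A (A₀.baseChange ℂ))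
    (f : 𝒳 ⟶ S) (n : ℕ) : cmLocus f n ⊆ qbarLocus f n := by
  rintro s ⟨A₀, he, hdim, hcm⟩
  exact ⟨A₀, he, hdim, hdesc A₀ hcm⟩

/-- Transport through an abelian chart `e : A'.X ≅ X` of Hodge for `A'`. [cite: GrothendieckTopology1969, §1] -/
theorem mem_algebraicClasses_of_chart_of_hodgeConjectureFor {X : SchemeOver ℂ} {n : ℕ} (A' : AbelianVariety ℂ)
    (e : A'.X ≅ X) (hdim : A'.dim = n) (hA' : HodgeConjectureFor A'.dim A'.X) {p : ℕ} {c : complexBetti X (2 * p)}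
    (hc : IsRationalClass c) (hpp : IsOfHodgeType n X (2 * p) p p c) : c ∈ algebraicClasses X p := by
  subst hdim
  exact (mem_algebraicClasses_map_iff_of_iso e).1
    (hA'.2 p _ ((isRationalClass_map_iff_of_iso e).2 hc) ((isOfHodgeType_map_iff_of_iso e).2 hpp))

/-- **`HC_QbarAV` at the `ℚ̄`-locus** — the ONLY place the endpoint is consumed: on a family with a fibrewise
rational `(p,p)` global class `W`, `HC_QbarAV` makes `W` algebraic at EVERY `ℚ̄`-fibre (`HC_QbarAV` for `A₁`,
`dim_baseChange`, van Geemen 3.7 along the isogeny, then the chart). [cite: vanGeemen1994HodgeAV, Lemma 3.7] -/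
theorem forall_qbarLocus_mem_algebraicClasses_of_HC_QbarAV (hQ : HodgeConjectureQbarAV) (f : 𝒳 ⟶ S)
    {n p : ℕ} (W : complexBetti 𝒳 (2 * p))
    (hW : ∀ s : ComplexPoints S, IsRationalClass (complexBetti.map (fiberι f s) (2 * p) W) ∧
      IsOfHodgeType n (fiberOver f s) (2 * p) p p (complexBetti.map (fiberι f s) (2 * p) W)) :
    ∀ s ∈ qbarLocus f n, complexBetti.map (fiberι f s) (2 * p) W ∈ algebraicClasses (fiberOver f s) p := by
  rintro s ⟨A₀, ⟨e⟩, hdim, A₁, hiso⟩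
  refine mem_algebraicClasses_of_chart_of_hodgeConjectureFor A₀ e hdim ?_ (hW s).1 (hW s).2
  exact HodgeConjectureFor.of_isIsogenous hiso (by simpa only [AbelianVariety.dim_baseChange] using hQ A₁)

/-! ## §B Per family: spreading from the `ℚ̄`-fibres, and from the CM fibres to the `ℚ̄`-fibres -/

/-- **`QbarSpreadingOn f n`** (per-family predicate): every fibrewise rational `(p,p)` global class `W` algebraic
at every `ℚ̄`-fibre of `f` is algebraic at every fibre — the transcendental half of row U on `f`.
[cite: CharlesSchnell2014Notes, Conj. 11.3.1 and Prop. 11.3.11] [cite: Voisin2007HodgeLoci, Thm. 0.6, Prop. 1.2] -/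
def QbarSpreadingOn (f : 𝒳 ⟶ S) (n : ℕ) : Prop :=
  ∀ (p : ℕ) (W : complexBetti 𝒳 (2 * p)),
    (∀ s : ComplexPoints S, IsRationalClass (complexBetti.map (fiberι f s) (2 * p) W) ∧
      IsOfHodgeType n (fiberOver f s) (2 * p) p p (complexBetti.map (fiberι f s) (2 * p) W)) →
    (∀ s ∈ qbarLocus f n, complexBetti.map (fiberι f s) (2 * p) W ∈ algebraicClasses (fiberOver f s) p) →
    ∀ t : ComplexPoints S, complexBetti.map (fiberι f t) (2 * p) W ∈ algebraicClasses (fiberOver f t) p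

/-- **`CMToQbarSpreadingOn f n`** (per-family predicate): every fibrewise rational `(p,p)` global class `W`
algebraic at every CM fibre of `f` is algebraic at every `ℚ̄`-fibre — the arithmetic half of row U on `f`.
[cite: Deligne1982HodgeCycles, Thm. 2.12 and Prop. 2.9] [cite: KerrPearlstein2016, Ch. 10 Thm. 1 and Cor. 1] -/
def CMToQbarSpreadingOn (f : 𝒳 ⟶ S) (n : ℕ) : Prop :=
  ∀ (p : ℕ) (W : complexBetti 𝒳 (2 * p)),
    (∀ s : ComplexPoints S, IsRationalClass (complexBetti.map (fiberι f s) (2 * p) W) ∧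
      IsOfHodgeType n (fiberOver f s) (2 * p) p p (complexBetti.map (fiberι f s) (2 * p) W)) →
    (∀ s ∈ cmLocus f n, complexBetti.map (fiberι f s) (2 * p) W ∈ algebraicClasses (fiberOver f s) p) →
    ∀ s ∈ qbarLocus f n, complexBetti.map (fiberι f s) (2 * p) W ∈ algebraicClasses (fiberOver f s) p

/-- CM-spreading to every fibre gives the arithmetic half, NO fact. [folklore] -/
theorem cmToQbarSpreadingOn_of_forall_cmSpreadingTo {f : 𝒳 ⟶ S} {n : ℕ}
    (h : ∀ s : ComplexPoints S, CMSpreadingTo f n s) : CMToQbarSpreadingOn f n :=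
  fun p W hW hcm s _ ↦ h s p W hW hcm

/-- The two halves give CM-spreading to every fibre, NO fact. [folklore] -/
theorem forall_cmSpreadingTo_of_qbarSpreadingOn_of_cmToQbarSpreadingOn {f : 𝒳 ⟶ S} {n : ℕ}
    (hQ : QbarSpreadingOn f n) (hC : CMToQbarSpreadingOn f n) : ∀ s : ComplexPoints S, CMSpreadingTo f n s :=
  fun s p W hW hcm ↦ hQ p W hW (hC p W hW hcm) s

/-- CM-spreading to every fibre gives the transcendental half MODULO `hdesc` (`cmLocus ⊆ qbarLocus`).
[cite: Shimura1998, §12.4 Prop. 26 (p. 97)] -/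
theorem qbarSpreadingOn_of_forall_cmSpreadingTo
    (hdesc : ∀ A : AbelianVariety ℂ, IsOfCMType A →
      ∃ A₀ : AbelianVariety ℚal, AbelianVariety.IsIsogenous A (A₀.baseChange ℂ))
    {f : 𝒳 ⟶ S} {n : ℕ} (h : ∀ s : ComplexPoints S, CMSpreadingTo f n s) : QbarSpreadingOn f n :=
  fun p W hW hqbar t ↦ h t p W hW fun s hs ↦ hqbar s (cmLocus_subset_qbarLocus_of_cmQbarDescent hdesc f n hs)

/-- The endpoint gives the arithmetic half on EVERY family, NO fact (the CM premise is not used).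
[cite: vanGeemen1994HodgeAV, Lemma 3.7] -/
theorem cmToQbarSpreadingOn_of_HC_QbarAV (hQ : HodgeConjectureQbarAV) (f : 𝒳 ⟶ S) (n : ℕ) :
    CMToQbarSpreadingOn f n :=
  fun _ W hW _ ↦ forall_qbarLocus_mem_algebraicClasses_of_HC_QbarAV hQ f W hW

/-- `HC_AV` gives the transcendental half on every family with abelian charts, NO fact (the premise at the
`ℚ̄`-fibres is not used). [cite: CharlesSchnell2014Notes, Cor. 11.3.6] -/
theorem qbarSpreadingOn_of_HC_AV (hAV : HodgeAbelianVarieties) (f : 𝒳 ⟶ S) {n : ℕ}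
    (hab : ∀ s : ComplexPoints S, ∃ A' : AbelianVariety ℂ, A'.dim = n ∧ Nonempty (A'.X ≅ fiberOver f s)) :
    QbarSpreadingOn f n := by
  intro p W hW _ t
  obtain ⟨A', hdim, ⟨e⟩⟩ := hab t
  exact mem_algebraicClasses_of_chart_of_hodgeConjectureFor A' e hdim (hAV A') (hW t).1 (hW t).2

/-! ## §C The three nodes (OPEN statements; hypotheses wherever used; never asserted) -/

/-- **U_ℚ̄ — UNIFORM ALGEBRAICITY AT `ℚ̄`-POINTS** (transcendental half of row U). On every smooth projective
family `f : 𝒳 ⟶ S` of relative dimension `n` with `𝒳`, `S` quasi-projective, `S` smooth irreducible, abelian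
charts at every fibre and DENSE CM locus (row U's carrier `Ring2.Deform.UniformAlgebraicityAtCMPoints` VERBATIM):
a fibrewise rational `(p,p)` global class algebraic at every `ℚ̄`-fibre is algebraic at every fibre. Implied by
U mod `hdesc` and by `HC_AV` fact-free; with `HC_QbarAV` it gives `HC_AV` mod `hF` (§E). WHY IT MIGHT FAIL / is
open: the `ℚ̄`-fibres are a countable dense set, the algebraicity locus a countable union of closed strata —
density forces nothing without bounded degree of the representing cycles; print controls fields of definition
of components of HODGE loci through `ℚ̄`-points, not algebraicity along them. NOT asserted; "minimal" not claimed.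
[cite: CharlesSchnell2014Notes, Conj. 11.3.1 and Prop. 11.3.11] [cite: KerrPearlstein2016, Ch. 10 Thm. 1, Cor. 1]
[cite: Voisin2007HodgeLoci, Thm. 0.6 and Prop. 1.2] [cite: KlinglerOtwinowskaUrbanik2023, Thm. 1.12] [status: open] -/
@[conjecture] def UniformAlgebraicityAtQbarPoints : Prop :=
  ∀ ⦃n : ℕ⦄ ⦃𝒳 S : SchemeOver ℂ⦄ (f : 𝒳 ⟶ S), IsSmoothProjectiveFamily f n →
    IsQuasiProjectiveOver 𝒳 → IsQuasiProjectiveOver S → IrreducibleSpace S.left → AlgebraicGeometry.Smooth S.hom →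
    (∀ s : ComplexPoints S, ∃ A' : AbelianVariety ℂ, A'.dim = n ∧ Nonempty (A'.X ≅ fiberOver f s)) →
    Dense (cmLocus f n) → QbarSpreadingOn f n

/-- **U_{CM→ℚ̄} — CM-TO-`ℚ̄` SPREADING** (arithmetic half of row U). On every family as in row U (carrier
VERBATIM): a fibrewise rational `(p,p)` global class algebraic at every CM fibre is algebraic at every `ℚ̄`-fibre.
Implied by U and by `HC_QbarAV` fact-free; with `HC_CM` it gives `HC_QbarAV` mod `hF` (§E). WHY IT MIGHT FAIL / is
open: it is the ALGEBRAIC (not absolute-Hodge) Principle B between two arithmetic fibres of a transcendental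
family; print gives absolute-Hodge transport (Deligne 2.12) and `ℚ̄`-definability of Hodge-locus components, not
algebraicity. NOT asserted; "minimal" not claimed. [cite: Deligne1982HodgeCycles, Thm. 2.12 and Prop. 2.9]
[cite: CharlesSchnell2014Notes, 11.3.11 and 11.5.11] [cite: KerrPearlstein2016, Ch. 10 Cor. 1–3] [status: open] -/
@[conjecture] def CMToQbarSpreading : Prop :=
  ∀ ⦃n : ℕ⦄ ⦃𝒳 S : SchemeOver ℂ⦄ (f : 𝒳 ⟶ S), IsSmoothProjectiveFamily f n →
    IsQuasiProjectiveOver 𝒳 → IsQuasiProjectiveOver S → IrreducibleSpace S.left → AlgebraicGeometry.Smooth S.hom →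
    (∀ s : ComplexPoints S, ∃ A' : AbelianVariety ℂ, A'.dim = n ∧ Nonempty (A'.X ≅ fiberOver f s)) →
    Dense (cmLocus f n) → CMToQbarSpreadingOn f n

/-- **F_ℚ̄ — HODGE FAILURES ON ABELIAN VARIETIES SPREAD TO `ℚ̄`-FIBRES** (failure form; part VII's F_CM with the
bad CM fibre replaced by a bad `ℚ̄`-fibre, the anchored datum `IsCMAnchoredDatumFor` VERBATIM). For every complex
abelian variety `A`, every `p` and every rational `(p,p)` class `c` on `A` which is NOT algebraic, there are an
anchored datum `(f, s, W)` for `(A, p, c)` and a `ℚ̄`-fibre `s' ∈ qbarLocus f n` at which `W` is NOT algebraic: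
no counterexample to Hodge on an abelian variety is invisible at all `ℚ̄`-fibres of all CM-pointed abelian
families carrying it. KERNEL (§F): `HC_AV ⟺ HC_QbarAV ∧ F_ℚ̄` and `Spread_AV ⟺ (HC_QbarAV → F_ℚ̄)` with NO
named fact; `F_CM ⟹ F_ℚ̄` mod `hdesc`; `U_ℚ̄ ⟹ F_ℚ̄` mod `hF`. OPEN; no print locator of its own; a HYPOTHESIS
wherever used; never asserted; "minimal" not claimed (F-ab-4). [cite: Deligne1982HodgeCycles, Prop. 6.1]
[cite: Andre1996Motifs, Lemme 6.3.1 (p. 31)] [cite: Voisin2007HodgeLoci, Thm. 0.6] [status: open] -/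
@[conjecture] def HodgeFailureSpreadsToQbarFibre : Prop :=
  ∀ (A : AbelianVariety ℂ), IsSmoothProjective A.dim A.X →
    ∀ (p : ℕ) (c : complexBetti A.X (2 * p)), IsRationalClass c → IsOfHodgeType A.dim A.X (2 * p) p p c →
      c ∉ algebraicClasses A.X p →
        ∃ (n : ℕ) (𝒳 S : SchemeOver ℂ) (f : 𝒳 ⟶ S) (s : ComplexPoints S) (W : complexBetti 𝒳 (2 * p)),
          IsCMAnchoredDatumFor A p c f n s W ∧
            ∃ s' ∈ qbarLocus f n, complexBetti.map (fiberι f s') (2 * p) W ∉ algebraicClasses (fiberOver f s') p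

/-! ## §D Row U factored: `U ⟺ U_ℚ̄ ∧ U_{CM→ℚ̄}` (mod `hdesc`), and the nodes on path -/

/-- **`U ⟹ U_{CM→ℚ̄}`**, NO fact. [folklore] -/
theorem cmToQbarSpreading_of_uniform (hU : UniformAlgebraicityAtCMPoints) : CMToQbarSpreading :=
  fun _ _ _ f hf h𝒳 hS hirr hsm hab hD p W hW hcm s _ ↦
    uniformAlgebraicityAtCMPoints_iff_spreading.1 hU f hf h𝒳 hS hirr hsm hab hD p W hW hcm s

/-- **`U_ℚ̄ ∧ U_{CM→ℚ̄} ⟹ U`**, NO fact. [folklore] -/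
theorem uniform_of_uniformQbar_of_cmToQbarSpreading (hQ : UniformAlgebraicityAtQbarPoints)
    (hC : CMToQbarSpreading) : UniformAlgebraicityAtCMPoints :=
  uniformAlgebraicityAtCMPoints_iff_spreading.2 fun _ _ _ f hf h𝒳 hS hirr hsm hab hD p W hW hcm ↦
    hQ f hf h𝒳 hS hirr hsm hab hD p W hW (hC f hf h𝒳 hS hirr hsm hab hD p W hW hcm)

/-- **`U ⟹ U_ℚ̄`** MODULO the descent `hdesc`. [cite: Shimura1998, §12.4 Prop. 26 (p. 97)] -/
theorem uniformQbar_of_uniform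
    (hdesc : ∀ A : AbelianVariety ℂ, IsOfCMType A →
      ∃ A₀ : AbelianVariety ℚal, AbelianVariety.IsIsogenous A (A₀.baseChange ℂ))
    (hU : UniformAlgebraicityAtCMPoints) : UniformAlgebraicityAtQbarPoints :=
  fun _ _ _ f hf h𝒳 hS hirr hsm hab hD ↦ qbarSpreadingOn_of_forall_cmSpreadingTo hdesc fun s p W hW hcm ↦
    uniformAlgebraicityAtCMPoints_iff_spreading.1 hU f hf h𝒳 hS hirr hsm hab hD p W hW hcm s

/-- **ROW U FACTORED: `U ⟺ U_ℚ̄ ∧ U_{CM→ℚ̄}`** modulo `hdesc`. [cite: Shimura1998, §12.4 Prop. 26 (p. 97)] -/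
theorem uniform_iff_uniformQbar_and_cmToQbarSpreading
    (hdesc : ∀ A : AbelianVariety ℂ, IsOfCMType A →
      ∃ A₀ : AbelianVariety ℚal, AbelianVariety.IsIsogenous A (A₀.baseChange ℂ)) :
    UniformAlgebraicityAtCMPoints ↔ UniformAlgebraicityAtQbarPoints ∧ CMToQbarSpreading :=
  ⟨fun hU ↦ ⟨uniformQbar_of_uniform hdesc hU, cmToQbarSpreading_of_uniform hU⟩,
    fun h ↦ uniform_of_uniformQbar_of_cmToQbarSpreading h.1 h.2⟩

/-- ON PATH, NO fact: **`HC_QbarAV ⟹ U_{CM→ℚ̄}`** (hence `HC_AV ⟹ U_{CM→ℚ̄}`). [cite: vanGeemen1994HodgeAV, 3.7] -/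
theorem cmToQbarSpreading_of_HC_QbarAV (hQ : HodgeConjectureQbarAV) : CMToQbarSpreading :=
  fun n _ _ f _ _ _ _ _ _ _ ↦ cmToQbarSpreadingOn_of_HC_QbarAV hQ f n

/-- ON PATH, NO fact: **`HC_AV ⟹ U_ℚ̄`**. [cite: CharlesSchnell2014Notes, Cor. 11.3.6] -/
theorem uniformQbar_of_HC_AV (hAV : HodgeAbelianVarieties) : UniformAlgebraicityAtQbarPoints :=
  fun _ _ _ f _ _ _ _ _ hab _ ↦ qbarSpreadingOn_of_HC_AV hAV f hab

/-- **`AbelianSchemeVHC ⟹ U_ℚ̄`** modulo `hdesc` (through deform's `AbelianSchemeVHC ⟹ U`): the suggested road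
needs no Hodge-locus carrier. [cite: CharlesSchnell2014Notes, Conj. 11.3.1] [cite: Shimura1998, §12.4 Prop. 26] -/
theorem uniformQbar_of_abelianSchemeVHC
    (hdesc : ∀ A : AbelianVariety ℂ, IsOfCMType A →
      ∃ A₀ : AbelianVariety ℚal, AbelianVariety.IsIsogenous A (A₀.baseChange ℂ))
    (hV : AbelianSchemeVHC) : UniformAlgebraicityAtQbarPoints :=
  uniformQbar_of_uniform hdesc (Deform.uniformAlgebraicityAtCMPoints_of_abelianSchemeVHC hV)

/-! ## §E Closing and exactness with Deligne's family fact: the two halves against `HC_QbarAV` and `HC_CM` -/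

/-- **`HC_QbarAV ∧ U_ℚ̄ ⟹ HC_AV`, granted Deligne's CM-dense Mumford–Tate families** (`hF`): on the family through
`(A, c)` the endpoint makes the global class algebraic at every `ℚ̄`-fibre (§A), U_ℚ̄ spreads it to every fibre,
transport along `e : A.X ≅ 𝒳_{s₁}`; `HC_CM` does NOT occur. [cite: CharlesSchnell2014Notes, Thm. 11.5.11] -/
theorem HC_AV_of_HC_QbarAV_of_uniformQbar (hF : deligne1982_cmDenseMumfordTateFamilies)
    (hQ : HodgeConjectureQbarAV) (hU : UniformAlgebraicityAtQbarPoints) : HodgeAbelianVarieties := by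
  refine iff_hodgeConjecture_restricted.2 fun A hA ↦ ?_
  refine (hodgeConjectureFor_iff_of_isSmoothProjective nonempty_hodgeModel_holds hA).2 ?_
  intro p c hc hpp
  obtain ⟨𝒳, S, f, s₁, e, W, hf, h𝒳, hS, hirr, hsm, hab, hW, hWc, hD⟩ := hF A hA p c hc hpp
  have hall :=
    hU f hf h𝒳 hS hirr hsm hab hD p W hW (forall_qbarLocus_mem_algebraicClasses_of_HC_QbarAV hQ f W hW)
  rw [← hWc]
  exact (mem_algebraicClasses_map_iff_of_iso e).2 (hall s₁)

/-- **`Spread_AV ⟸ U_ℚ̄`** mod `hF` (deform D.69 (c)): ONE node strictly below U, no `HC_CM`. [folklore] -/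
theorem cmIdle_qbarAV_of_deligne1982_of_uniformQbar (hF : deligne1982_cmDenseMumfordTateFamilies)
    (hU : UniformAlgebraicityAtQbarPoints) : CMIdle HodgeConjectureQbarAV :=
  fun hQ ↦ HC_AV_of_HC_QbarAV_of_uniformQbar hF hQ hU

/-- **EXACT ROW against the endpoint: `HC_AV ⟺ HC_QbarAV ∧ U_ℚ̄`** mod `hF`. [cite: CharlesSchnell2014Notes] -/
theorem HC_AV_iff_HC_QbarAV_and_uniformQbar (hF : deligne1982_cmDenseMumfordTateFamilies) :
    HodgeAbelianVarieties ↔ HodgeConjectureQbarAV ∧ UniformAlgebraicityAtQbarPoints :=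
  ⟨fun h ↦ ⟨hodgeConjectureQbarAV_of_HC_AV h, uniformQbar_of_HC_AV h⟩,
    fun h ↦ HC_AV_of_HC_QbarAV_of_uniformQbar hF h.1 h.2⟩

/-- **`HC_CM ∧ U_{CM→ℚ̄} ⟹ HC_QbarAV`**, granted `hF`: on the family through `(A₁ ⊗ ℂ, c)`, `HC_CM` (a hypothesis
BY NAME) makes the global class algebraic at every CM fibre (deform), the arithmetic half moves this to every
`ℚ̄`-fibre, and `s₁` IS a `ℚ̄`-fibre; finally `dim_baseChange`. [cite: Milne1999, §7 p. 72 (hypothesis (H))]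
[cite: CharlesSchnell2014Notes, Thm. 11.5.11] [cite: Deligne1982HodgeCycles, Prop. 6.1] -/
theorem HC_QbarAV_of_HC_CM_of_cmToQbarSpreading (hF : deligne1982_cmDenseMumfordTateFamilies)
    (hCM : CMAbelianHodge) (h : CMToQbarSpreading) : HodgeConjectureQbarAV := by
  intro A₁
  have hA : IsSmoothProjective (A₁.baseChange ℂ).dim (A₁.baseChange ℂ).X :=
    AbelianVariety.isSmoothProjective_holds (A := A₁.baseChange ℂ)
  have hHC : HodgeConjectureFor (A₁.baseChange ℂ).dim (A₁.baseChange ℂ).X := by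
    refine (hodgeConjectureFor_iff_of_isSmoothProjective nonempty_hodgeModel_holds hA).2 ?_
    intro p c hc hpp
    obtain ⟨𝒳, S, f, s₁, e, W, hf, h𝒳, hS, hirr, hsm, hab, hW, hWc, hD⟩ := hF _ hA p c hc hpp
    have hq := h f hf h𝒳 hS hirr hsm hab hD p W hW (forall_cmLocus_mem_algebraicClasses_of_HC_CM hCM f W hW)
    rw [← hWc]
    exact (mem_algebraicClasses_map_iff_of_iso e).2 (hq s₁ (mem_qbarLocus_of_baseChange_chart f A₁ e))
  simpa only [AbelianVariety.dim_baseChange] using hHC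

/-- **EXACT ROW against `HC_CM`: `HC_QbarAV ⟺ HC_CM ∧ U_{CM→ℚ̄}`** modulo `hF` (←) and `hdesc` (→, deform XV §2).
In print `HC_CM` is not known to follow from U_{CM→ℚ̄}. [cite: Shimura1998, §12.4 Prop. 26 (p. 97)] -/
theorem HC_QbarAV_iff_HC_CM_and_cmToQbarSpreading (hF : deligne1982_cmDenseMumfordTateFamilies)
    (hdesc : ∀ A : AbelianVariety ℂ, IsOfCMType A →
      ∃ A₀ : AbelianVariety ℚal, AbelianVariety.IsIsogenous A (A₀.baseChange ℂ)) :
    HodgeConjectureQbarAV ↔ CMAbelianHodge ∧ CMToQbarSpreading :=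
  ⟨fun hQ ↦ ⟨HC_CM_of_hodgeConjectureQbarAV_of_cmQbarDescent hdesc hQ, cmToQbarSpreading_of_HC_QbarAV hQ⟩,
    fun h ↦ HC_QbarAV_of_HC_CM_of_cmToQbarSpreading hF h.1 h.2⟩

/-- **`ExactWithCM (U_{CM→ℚ̄} ∧ U_ℚ̄)`** granted `hF` ONLY: `HC_AV ⟺ HC_CM ∧ (U_{CM→ℚ̄} ∧ U_ℚ̄)` — row U through
the `ℚ̄`-fibres (first `HC_QbarAV`, then §E's closing; `→` fact-free through the endpoint); Frame I's
`cmToAbelian_of_closesWithCM` then types `(U_{CM→ℚ̄} ∧ U_ℚ̄) ⟹ CMToAbelian` (stmt-HodgeConjecture-16267 stays OPEN).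
[cite: Deligne1982HodgeCycles, §6 (pp. 71–73)] [cite: CharlesSchnell2014Notes, Cor. 11.3.6 and Thm. 11.5.11] -/
theorem exactWithCM_cmToQbarSpreading_and_uniformQbar (hF : deligne1982_cmDenseMumfordTateFamilies) :
    ExactWithCM (CMToQbarSpreading ∧ UniformAlgebraicityAtQbarPoints) :=
  ⟨fun h ↦ ⟨Deform.HC_CM_of_HC_AV h, cmToQbarSpreading_of_HC_QbarAV (hodgeConjectureQbarAV_of_HC_AV h),
      uniformQbar_of_HC_AV h⟩,
    fun h ↦ HC_AV_of_HC_QbarAV_of_uniformQbar hF (HC_QbarAV_of_HC_CM_of_cmToQbarSpreading hF h.1 h.2.1) h.2.2⟩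

/-! ## §F The failure form F_ℚ̄: the endpoint's exact complement with NO named fact -/

/-- **`HC_QbarAV → F_ℚ̄ → HC_AV` — NO named fact.** Were a rational `(p,p)` class `c` on `A` not algebraic,
F_ℚ̄ would give an anchored datum and a `ℚ̄`-fibre at which the global class is NOT algebraic, while the endpoint
makes it algebraic there (§A). Anchor and CM point unused. [cite: vanGeemen1994HodgeAV, Lemma 3.7] -/
theorem HC_AV_of_HC_QbarAV_of_hodgeFailureSpreadsToQbarFibre (hQ : HodgeConjectureQbarAV)
    (h : HodgeFailureSpreadsToQbarFibre) : HodgeAbelianVarieties := by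
  refine iff_hodgeConjecture_restricted.2 fun A hA ↦ ?_
  refine (hodgeConjectureFor_iff_of_isSmoothProjective nonempty_hodgeModel_holds hA).2 ?_
  intro p c hc hpp
  by_contra hnc
  obtain ⟨n, 𝒳, S, f, s, W, hd, s', hs', hns'⟩ := h A hA p c hc hpp hnc
  exact hns' (forall_qbarLocus_mem_algebraicClasses_of_HC_QbarAV hQ f W hd.2.1 s' hs')

/-- ON PATH, NO fact: **`HC_AV ⟹ F_ℚ̄`** (nothing triggers it). [folklore] -/
theorem onPathAV_hodgeFailureSpreadsToQbarFibre : OnPathAV HodgeFailureSpreadsToQbarFibre :=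
  fun hAV A _ p c hc hpp hnc ↦ absurd ((hAV A).2 p c hc hpp) hnc

/-- **EXACT, NO named fact: `HC_AV ⟺ HC_QbarAV ∧ F_ℚ̄`** — an exact complement of the endpoint. [folklore] -/
theorem HC_AV_iff_HC_QbarAV_and_hodgeFailureSpreadsToQbarFibre :
    HodgeAbelianVarieties ↔ HodgeConjectureQbarAV ∧ HodgeFailureSpreadsToQbarFibre :=
  ⟨fun h ↦ ⟨hodgeConjectureQbarAV_of_HC_AV h, onPathAV_hodgeFailureSpreadsToQbarFibre h⟩,
    fun h ↦ HC_AV_of_HC_QbarAV_of_hodgeFailureSpreadsToQbarFibre h.1 h.2⟩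

/-- **DEFORM'S `Spread_AV` UNFOLDED, NO named fact: `Spread_AV ⟺ (HC_QbarAV → F_ℚ̄)`** — "Hodge for abelian
varieties spreads from `ℚ̄` to `ℂ`" = "granted the endpoint, Hodge failures spread to `ℚ̄`-fibres". [folklore] -/
theorem cmIdle_qbarAV_iff_imp_hodgeFailureSpreadsToQbarFibre :
    CMIdle HodgeConjectureQbarAV ↔ (HodgeConjectureQbarAV → HodgeFailureSpreadsToQbarFibre) :=
  ⟨fun h hQ ↦ onPathAV_hodgeFailureSpreadsToQbarFibre (h hQ),
    fun h hQ ↦ HC_AV_of_HC_QbarAV_of_hodgeFailureSpreadsToQbarFibre hQ (h hQ)⟩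

/-- **`F_CM ⟹ F_ℚ̄`** modulo `hdesc` (a bad CM fibre is a bad `ℚ̄`-fibre). [cite: Shimura1998, §12.4 Prop. 26] -/
theorem hodgeFailureSpreadsToQbarFibre_of_hodgeFailureSpreadsToCMFibre
    (hdesc : ∀ A : AbelianVariety ℂ, IsOfCMType A →
      ∃ A₀ : AbelianVariety ℚal, AbelianVariety.IsIsogenous A (A₀.baseChange ℂ))
    (h : HodgeFailureSpreadsToCMFibre) : HodgeFailureSpreadsToQbarFibre := by
  intro A hA p c hc hpp hnc
  obtain ⟨n, 𝒳, S, f, s, W, hd, s', hs', hns'⟩ := h A hA p c hc hpp hnc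
  exact ⟨n, 𝒳, S, f, s, W, hd, s', cmLocus_subset_qbarLocus_of_cmQbarDescent hdesc f n hs', hns'⟩

/-- **`U_ℚ̄ ⟹ F_ℚ̄`** granted `hF`: Deligne's family through `(A, c)` is an anchored datum carrying `c` on the nose
(part VII) with dense CM locus; were the global class algebraic at every `ℚ̄`-fibre, U_ℚ̄ would make it algebraic
at the anchor, hence `c` algebraic. [cite: CharlesSchnell2014Notes, Thm. 11.5.11] [cite: Andre1996Motifs, §6.3 a)] -/
theorem hodgeFailureSpreadsToQbarFibre_of_deligne1982_of_uniformQbar (hF : deligne1982_cmDenseMumfordTateFamilies)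
    (hU : UniformAlgebraicityAtQbarPoints) : HodgeFailureSpreadsToQbarFibre := by
  intro A hA p c hc hpp hnc
  obtain ⟨𝒳, S, f, hfam⟩ := hF A hA p c hc hpp
  have hD : Dense (cmLocus f A.dim) := hfam.dense_cmLocus
  obtain ⟨s, W, hd, _⟩ := exists_datum_of_isCMDenseMumfordTateFamilyFor hfam
  refine ⟨A.dim, 𝒳, S, f, s, W, hd, ?_⟩
  by_contra hall
  push Not at hall
  obtain ⟨hf, h𝒳, hS, hirr, hsm, hab, _⟩ := hd.1
  exact hnc (mem_algebraicClasses_of_isCMAnchoredDatumFor hA hd (hU f hf h𝒳 hS hirr hsm hab hD p W hd.2.1 hall s))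

/-- ON-PATH audit from the summit, NO fact: `HodgeConjecture ⟹ U_ℚ̄ ∧ U_{CM→ℚ̄} ∧ F_ℚ̄`. [folklore] -/
theorem qbarSpread_nodes_of_hodgeConjecture (hHC : _root_.HodgeConjecture) :
    UniformAlgebraicityAtQbarPoints ∧ CMToQbarSpreading ∧ HodgeFailureSpreadsToQbarFibre :=
  ⟨uniformQbar_of_HC_AV (Deform.HC_AV_of_hodgeConjecture hHC),
    cmToQbarSpreading_of_HC_QbarAV (hodgeConjectureQbarAV_of_HC_AV (Deform.HC_AV_of_hodgeConjecture hHC)),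
    of_onPathAV_of_hodgeConjecture onPathAV_hodgeFailureSpreadsToQbarFibre hHC⟩

end Summit.HodgeConjecture.HodgeConjecture.Ring2.AbelianAll
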